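import Mathlib
import Literature.Computability.AlgebraicComplexity.StandardFamilies
import Literature.Computability.AlgebraicComplexity.MignonRessayreBound
import Summits.ValiantsHypothesis.ValiantsHypothesis.Theorems.PrincipalMinorColouringExcessRankUnboundedExtract
import Summits.ValiantsHypothesis.ValiantsHypothesis.Theorems.PrincipalMinorColouringExcessRankUnboundedCore

/-!
# Route PrincipalMinorColouring, item `ExcessRankUnbounded` (stmt-ValiantsHypothesis-3783) —
part 3/4: principal minors on a `3 × 3` frame of fibre-one cells

A FRAME is a choice of three rows `r : Fin 3 → Fin n`, three columns `c : Fin 3 → Fin n` (both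
injective) and, for each of the nine cells `(r p, c q)`, the UNIQUE index `ι p q` of that colour
(`κ j = (r p, c q) ↔ j = ι p q`). On such cells the coefficient of a multilinear monomial in
`det(1 + diag(x ∘ κ) K)` is a single principal minor of `K`, while in `per_n(x + J)` it counts
permutations through the cells (`card_perm_apply_eq_one/two` of `MignonRessayreBound`):

* `frame_triple`: for three distinct frame cells, diagonal entries `= (n-1)!/n! =: a`, pair
  products `K(e,e')K(e',e) = a²` (attacking) or `a² - (n-2)!/n!` (non-attacking), and the
  `3 × 3` principal minor vanishes when two of the cells attack;
* `frame_comp_col`, `frame_comp_free`, `frame_L`: the resulting composition rules / L-shape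
  relations (via `comp_of_minors`, `L_of_minors` of part 2);
* `sq_sub_ne_zero`: `a² - (n-2)!/n! ≠ 0` for `n ≥ 2`.
-/

set_option linter.dupNamespace false

namespace Summit.ValiantsHypothesis.ValiantsHypothesis.Theorems.PrincipalMinorColouring

open MvPolynomial Matrix Finset Literature.Computability.AlgebraicComplexity

variable {n R : ℕ}

/-! ### Counting permutations through one or two cells -/

/-- `∑_σ [σ c = r] = (n-1)!` over `𝔖ₙ` (as a complex number). [folklore] -/
theorem sum_ite_apply_eq (r c : Fin n) :
    (∑ σ : Equiv.Perm (Fin n), (if σ c = r then (1 : ℂ) else 0)) = ((n - 1).factorial : ℂ) := by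
  rw [Finset.sum_boole, ← Fintype.card_subtype, card_perm_apply_eq_one c r, Fintype.card_fin]

/-- Two distinct attacking cells (same row or same column) lie on no common permutation:
`[σ c₀ = r₀] · [σ c₁ = r₁] = 0`. [folklore] -/
theorem ite_mul_ite_eq_zero_of_attacking {r0 c0 r1 c1 : Fin n} (hne : (r0, c0) ≠ (r1, c1))
    (hatt : r0 = r1 ∨ c0 = c1) (σ : Equiv.Perm (Fin n)) :
    (if σ c0 = r0 then (1 : ℂ) else 0) * (if σ c1 = r1 then (1 : ℂ) else 0) = 0 := by
  by_cases h0 : σ c0 = r0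
  · by_cases h1 : σ c1 = r1
    · exfalso
      rcases hatt with h | h
      · subst h
        exact hne (Prod.ext rfl (σ.injective (h0.trans h1.symm)))
      · subst h
        exact hne (Prod.ext (h0.symm.trans h1) rfl)
    · simp [h1]
  · simp [h0]

/-- `∑_σ [σ c₀ = r₀][σ c₁ = r₁] = (n-2)!` for two non-attacking cells. [folklore] -/
theorem sum_ite_mul_ite_of_nonattacking {r0 c0 r1 c1 : Fin n} (hr : r0 ≠ r1) (hc : c0 ≠ c1) :
    (∑ σ : Equiv.Perm (Fin n),
      (if σ c0 = r0 then (1 : ℂ) else 0) * (if σ c1 = r1 then (1 : ℂ) else 0)) =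
      ((n - 2).factorial : ℂ) := by
  have : ∀ σ : Equiv.Perm (Fin n),
      (if σ c0 = r0 then (1 : ℂ) else 0) * (if σ c1 = r1 then (1 : ℂ) else 0) =
        if σ c0 = r0 ∧ σ c1 = r1 then (1 : ℂ) else 0 := fun σ => by
    simp only [ite_mul, one_mul, zero_mul, ← ite_and]
  rw [Finset.sum_congr rfl fun σ _ => this σ, Finset.sum_boole, ← Fintype.card_subtype,
    card_perm_apply_eq_two hc hr, Fintype.card_fin]

/-! ### The principal minors on a `3 × 3` frame of fibre-one cells -/

/-- **Frame facts.** Let `r, c : Fin 3 → Fin n` be injective (three rows, three columns) and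
`ι p q` the UNIQUE index of colour `(r p, c q)` (fibre-one cells). For any three distinct frame
cells `(p m, q m)` the entries of `K` satisfy: diagonal `= (n-1)!/n!`; product of the two
off-diagonal entries of a pair `= ((n-1)!/n!)² - [non-attacking] (n-2)!/n!`; and the `3 × 3`
principal minor vanishes as soon as two of the three cells attack each other. [folklore] -/
theorem frame_triple {K : Matrix (Fin R) (Fin R) ℂ} {κ : Fin R → Fin n × Fin n}
    (hrepr : MvPolynomial.aeval (fun e => MvPolynomial.X e + 1) (perPoly (Fin n) ℂ) =
      MvPolynomial.C (n.factorial : ℂ) * (1 + Matrix.diagonal (fun i => MvPolynomial.X (κ i)) *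
        K.map (fun a : ℂ => (MvPolynomial.C a : MvPolynomial (Fin n × Fin n) ℂ))).det)
    {r c : Fin 3 → Fin n} (hr : Function.Injective r) (hc : Function.Injective c)
    {ι : Fin 3 → Fin 3 → Fin R} (hι : ∀ p q j, κ j = (r p, c q) ↔ j = ι p q)
    (p q : Fin 3 → Fin 3) (hd : ∀ m m', p m = p m' → q m = q m' → m = m') :
    (K (ι (p 0) (q 0)) (ι (p 0) (q 0)) = ((n - 1).factorial : ℂ) / (n.factorial : ℂ)) ∧
    (K (ι (p 1) (q 1)) (ι (p 1) (q 1)) = ((n - 1).factorial : ℂ) / (n.factorial : ℂ)) ∧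
    (K (ι (p 2) (q 2)) (ι (p 2) (q 2)) = ((n - 1).factorial : ℂ) / (n.factorial : ℂ)) ∧
    (K (ι (p 0) (q 0)) (ι (p 1) (q 1)) * K (ι (p 1) (q 1)) (ι (p 0) (q 0)) =
      (((n - 1).factorial : ℂ) / (n.factorial : ℂ)) ^ 2 -
        if p 0 ≠ p 1 ∧ q 0 ≠ q 1 then ((n - 2).factorial : ℂ) / (n.factorial : ℂ) else 0) ∧
    (K (ι (p 0) (q 0)) (ι (p 2) (q 2)) * K (ι (p 2) (q 2)) (ι (p 0) (q 0)) =
      (((n - 1).factorial : ℂ) / (n.factorial : ℂ)) ^ 2 -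
        if p 0 ≠ p 2 ∧ q 0 ≠ q 2 then ((n - 2).factorial : ℂ) / (n.factorial : ℂ) else 0) ∧
    (K (ι (p 1) (q 1)) (ι (p 2) (q 2)) * K (ι (p 2) (q 2)) (ι (p 1) (q 1)) =
      (((n - 1).factorial : ℂ) / (n.factorial : ℂ)) ^ 2 -
        if p 1 ≠ p 2 ∧ q 1 ≠ q 2 then ((n - 2).factorial : ℂ) / (n.factorial : ℂ) else 0) ∧
    (((p 0 = p 1 ∨ q 0 = q 1) ∨ (p 0 = p 2 ∨ q 0 = q 2) ∨ (p 1 = p 2 ∨ q 1 = q 2)) →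
      K (ι (p 0) (q 0)) (ι (p 0) (q 0)) * K (ι (p 1) (q 1)) (ι (p 1) (q 1)) *
          K (ι (p 2) (q 2)) (ι (p 2) (q 2))
        - K (ι (p 0) (q 0)) (ι (p 0) (q 0)) * K (ι (p 1) (q 1)) (ι (p 2) (q 2)) *
          K (ι (p 2) (q 2)) (ι (p 1) (q 1))
        - K (ι (p 0) (q 0)) (ι (p 1) (q 1)) * K (ι (p 1) (q 1)) (ι (p 0) (q 0)) *
          K (ι (p 2) (q 2)) (ι (p 2) (q 2))
        + K (ι (p 0) (q 0)) (ι (p 1) (q 1)) * K (ι (p 1) (q 1)) (ι (p 2) (q 2)) *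
          K (ι (p 2) (q 2)) (ι (p 0) (q 0))
        + K (ι (p 0) (q 0)) (ι (p 2) (q 2)) * K (ι (p 1) (q 1)) (ι (p 0) (q 0)) *
          K (ι (p 2) (q 2)) (ι (p 1) (q 1))
        - K (ι (p 0) (q 0)) (ι (p 2) (q 2)) * K (ι (p 1) (q 1)) (ι (p 1) (q 1)) *
          K (ι (p 2) (q 2)) (ι (p 0) (q 0)) = 0) := by
  -- the three indices and their colours
  set e : Fin 3 → Fin R := fun m => ι (p m) (q m) with he
  have hκe : ∀ m, κ (e m) = (r (p m), c (q m)) := fun m => (hι (p m) (q m) (e m)).mpr rfl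
  have hcls : ∀ m j, κ j = κ (e m) → j = e m := fun m j h =>
    (hι (p m) (q m) j).mp (h.trans (hκe m))
  have hcell : ∀ m m', (r (p m), c (q m)) = (r (p m'), c (q m')) → m = m' := fun m m' h =>
    hd m m' (hr (congrArg Prod.fst h)) (hc (congrArg Prod.snd h))
  have hinj : Function.Injective e := fun m m' h =>
    hcell m m' ((hκe m).symm.trans ((congrArg κ h).trans (hκe m')))
  obtain ⟨h0, h1, h2, h01, h02, h12, h012⟩ := triple_minors hrepr e hcls hinj
  simp only [hκe] at h0 h1 h2 h01 h02 h12 h012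
  rw [sum_ite_apply_eq] at h0 h1 h2
  have hN : (n.factorial : ℂ) ≠ 0 := Nat.cast_ne_zero.mpr (Nat.factorial_ne_zero n)
  have hdiag : ∀ {x : ℂ}, (n.factorial : ℂ) * x = ((n - 1).factorial : ℂ) →
      x = ((n - 1).factorial : ℂ) / (n.factorial : ℂ) := fun h => by
    rw [eq_div_iff hN, mul_comm]; exact h
  have hd0 := hdiag h0
  have hd1 := hdiag h1
  have hd2 := hdiag h2
  -- pairs
  have hpair : ∀ {m m' : Fin 3} {x : ℂ}, m ≠ m' →
      (n.factorial : ℂ) * (((n - 1).factorial : ℂ) / (n.factorial : ℂ) *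
          (((n - 1).factorial : ℂ) / (n.factorial : ℂ)) - x) =
        ∑ σ : Equiv.Perm (Fin n), (if σ (c (q m)) = r (p m) then (1 : ℂ) else 0) *
          (if σ (c (q m')) = r (p m') then (1 : ℂ) else 0) →
      x = (((n - 1).factorial : ℂ) / (n.factorial : ℂ)) ^ 2 -
        if p m ≠ p m' ∧ q m ≠ q m' then ((n - 2).factorial : ℂ) / (n.factorial : ℂ) else 0 := by
    intro m m' x hmm h
    have hne : (r (p m), c (q m)) ≠ (r (p m'), c (q m')) := fun h' => hmm (hcell m m' h')
    split_ifs with hna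
    · rw [sum_ite_mul_ite_of_nonattacking (hr.ne hna.1) (hc.ne hna.2)] at h
      rw [← h, mul_div_cancel_left₀ _ hN]
      ring
    · have hatt : r (p m) = r (p m') ∨ c (q m) = c (q m') := by
        by_cases hp : p m = p m'
        · exact Or.inl (congrArg r hp)
        · exact Or.inr (congrArg c (by tauto))
      rw [Finset.sum_eq_zero fun σ _ => ite_mul_ite_eq_zero_of_attacking hne hatt σ] at h
      have : (n.factorial : ℂ) * (((n - 1).factorial : ℂ) / (n.factorial : ℂ) *
          (((n - 1).factorial : ℂ) / (n.factorial : ℂ)) - x) = (n.factorial : ℂ) * 0 := by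
        rw [h, mul_zero]
      have := mul_left_cancel₀ hN this
      linear_combination (-1 : ℂ) * this
  rw [hd0, hd1] at h01
  rw [hd0, hd2] at h02
  rw [hd1, hd2] at h12
  refine ⟨hd0, hd1, hd2, hpair (by decide) h01, hpair (by decide) h02, hpair (by decide) h12,
    fun hatt => ?_⟩
  -- the triple: some pair attacks, so every term of the correlation sum vanishes
  have hzero : ∀ σ : Equiv.Perm (Fin n),
      (if σ (c (q 0)) = r (p 0) then (1 : ℂ) else 0) * (if σ (c (q 1)) = r (p 1) then (1 : ℂ) else 0)
        * (if σ (c (q 2)) = r (p 2) then (1 : ℂ) else 0) = 0 := by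
    intro σ
    have hne : ∀ m m', m ≠ m' → (r (p m), c (q m)) ≠ (r (p m'), c (q m')) :=
      fun m m' hmm h' => hmm (hcell m m' h')
    rcases hatt with h | h | h
    · rw [ite_mul_ite_eq_zero_of_attacking (hne 0 1 (by decide))
        (h.imp (congrArg r) (congrArg c)) σ, zero_mul]
    · rw [mul_right_comm, ite_mul_ite_eq_zero_of_attacking (hne 0 2 (by decide))
        (h.imp (congrArg r) (congrArg c)) σ, zero_mul]
    · rw [mul_assoc, ite_mul_ite_eq_zero_of_attacking (hne 1 2 (by decide))
        (h.imp (congrArg r) (congrArg c)) σ, mul_zero]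
  rw [Finset.sum_eq_zero fun σ _ => hzero σ, mul_eq_zero] at h012
  have hdet := h012.resolve_left hN
  rw [Matrix.det_fin_three] at hdet
  simpa only [Matrix.submatrix_apply, he] using hdet

/-! ### Numerical facts about `a = (n-1)!/n!` and `b = (n-2)!/n!` -/

/-- `(n-1)!/n! ≠ 0` in `ℂ`. [folklore] -/
theorem factorial_pred_div_ne_zero (n : ℕ) :
    ((n - 1).factorial : ℂ) / (n.factorial : ℂ) ≠ 0 :=
  div_ne_zero (Nat.cast_ne_zero.mpr (Nat.factorial_ne_zero _))
    (Nat.cast_ne_zero.mpr (Nat.factorial_ne_zero _))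

/-- `(n-2)!/n! ≠ 0` in `ℂ`. [folklore] -/
theorem factorial_pred_pred_div_ne_zero (n : ℕ) :
    ((n - 2).factorial : ℂ) / (n.factorial : ℂ) ≠ 0 :=
  div_ne_zero (Nat.cast_ne_zero.mpr (Nat.factorial_ne_zero _))
    (Nat.cast_ne_zero.mpr (Nat.factorial_ne_zero _))

/-- `((n-1)!/n!)² - (n-2)!/n! = 1/n² - 1/(n(n-1)) ≠ 0` for `n ≥ 2`. [folklore] -/
theorem sq_sub_ne_zero (hn : 2 ≤ n) :
    (((n - 1).factorial : ℂ) / (n.factorial : ℂ)) ^ 2 - ((n - 2).factorial : ℂ) / (n.factorial : ℂ)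
      ≠ 0 := by
  obtain ⟨m, rfl⟩ : ∃ m, n = m + 2 := ⟨n - 2, by omega⟩
  rw [show m + 2 - 1 = m + 1 from rfl, show m + 2 - 2 = m from rfl]
  have hf1 : ((m + 1).factorial : ℂ) = ((m : ℂ) + 1) * (m.factorial : ℂ) := by
    push_cast [Nat.factorial_succ]; ring
  have hf2 : ((m + 2).factorial : ℂ) = ((m : ℂ) + 2) * ((m : ℂ) + 1) * (m.factorial : ℂ) := by
    push_cast [Nat.factorial_succ]; ring
  have hm : (m.factorial : ℂ) ≠ 0 := Nat.cast_ne_zero.mpr (Nat.factorial_ne_zero _)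
  have h1 : ((m : ℂ) + 1) ≠ 0 := by exact_mod_cast Nat.succ_ne_zero m
  have h2 : ((m : ℂ) + 2) ≠ 0 := by exact_mod_cast Nat.succ_ne_zero (m + 1)
  rw [hf1, hf2]
  have : (((m : ℂ) + 1) * (m.factorial : ℂ) / (((m : ℂ) + 2) * ((m : ℂ) + 1) * (m.factorial : ℂ))) ^ 2
      - (m.factorial : ℂ) / (((m : ℂ) + 2) * ((m : ℂ) + 1) * (m.factorial : ℂ))
      = -1 / (((m : ℂ) + 2) ^ 2 * ((m : ℂ) + 1)) := by
    field_simp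
    ring
  rw [this]
  exact div_ne_zero (by norm_num) (mul_ne_zero (pow_ne_zero 2 h2) h1)

/-! ### The three local configurations on a frame -/

section Configurations

variable {K : Matrix (Fin R) (Fin R) ℂ} {κ : Fin R → Fin n × Fin n}
  {r c : Fin 3 → Fin n} {ι : Fin 3 → Fin 3 → Fin R}

/-- **Collinear triple.** Three distinct frame cells, pairwise attacking (hence all in one row or
all in one column): `K(e₀,e₁)K(e₁,e₂) = a K(e₀,e₂)`, `K(e₂,e₁)K(e₁,e₀) = a K(e₂,e₀)` and
`K(e₀,e₁)K(e₁,e₀) = a²`. [folklore] -/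
theorem frame_comp_col
    (hrepr : MvPolynomial.aeval (fun e => MvPolynomial.X e + 1) (perPoly (Fin n) ℂ) =
      MvPolynomial.C (n.factorial : ℂ) * (1 + Matrix.diagonal (fun i => MvPolynomial.X (κ i)) *
        K.map (fun a : ℂ => (MvPolynomial.C a : MvPolynomial (Fin n × Fin n) ℂ))).det)
    (hr : Function.Injective r) (hc : Function.Injective c)
    (hι : ∀ p q j, κ j = (r p, c q) ↔ j = ι p q)
    (p q : Fin 3 → Fin 3) (hd : ∀ m m', p m = p m' → q m = q m' → m = m')
    (h01 : p 0 = p 1 ∨ q 0 = q 1) (h02 : p 0 = p 2 ∨ q 0 = q 2) (h12 : p 1 = p 2 ∨ q 1 = q 2) :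
    K (ι (p 0) (q 0)) (ι (p 1) (q 1)) * K (ι (p 1) (q 1)) (ι (p 2) (q 2)) =
      ((n - 1).factorial : ℂ) / (n.factorial : ℂ) * K (ι (p 0) (q 0)) (ι (p 2) (q 2)) ∧
    K (ι (p 2) (q 2)) (ι (p 1) (q 1)) * K (ι (p 1) (q 1)) (ι (p 0) (q 0)) =
      ((n - 1).factorial : ℂ) / (n.factorial : ℂ) * K (ι (p 2) (q 2)) (ι (p 0) (q 0)) ∧
    K (ι (p 0) (q 0)) (ι (p 1) (q 1)) * K (ι (p 1) (q 1)) (ι (p 0) (q 0)) =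
      (((n - 1).factorial : ℂ) / (n.factorial : ℂ)) ^ 2 := by
  obtain ⟨d0, d1, d2, w01, w02, w12, hdet⟩ := frame_triple hrepr hr hc hι p q hd
  rw [if_neg (fun h => h01.elim h.1 h.2), sub_zero] at w01
  rw [if_neg (fun h => h02.elim h.1 h.2), sub_zero] at w02
  rw [if_neg (fun h => h12.elim h.1 h.2), sub_zero] at w12
  obtain ⟨c1, c2⟩ := comp_of_minors (pow_ne_zero 2 (factorial_pred_div_ne_zero n)) d0 d1 d2
    w01 w12 w02 (hdet (Or.inl h01))
  exact ⟨c1, c2, w01⟩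

/-- **Attacking pair plus a free cell.** `e₀ ~ e₁` attacking, `e₂` attacking neither:
`K(e₀,e₁)K(e₁,e₂) = a K(e₀,e₂)`, `K(e₂,e₁)K(e₁,e₀) = a K(e₂,e₀)`, `K(e₀,e₁)K(e₁,e₀) = a²` and
`K(e₁,e₂)K(e₂,e₁) = a² - b`. [folklore] -/
theorem frame_comp_free (hn : 2 ≤ n)
    (hrepr : MvPolynomial.aeval (fun e => MvPolynomial.X e + 1) (perPoly (Fin n) ℂ) =
      MvPolynomial.C (n.factorial : ℂ) * (1 + Matrix.diagonal (fun i => MvPolynomial.X (κ i)) *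
        K.map (fun a : ℂ => (MvPolynomial.C a : MvPolynomial (Fin n × Fin n) ℂ))).det)
    (hr : Function.Injective r) (hc : Function.Injective c)
    (hι : ∀ p q j, κ j = (r p, c q) ↔ j = ι p q)
    (p q : Fin 3 → Fin 3) (hd : ∀ m m', p m = p m' → q m = q m' → m = m')
    (h01 : p 0 = p 1 ∨ q 0 = q 1) (h02 : p 0 ≠ p 2 ∧ q 0 ≠ q 2) (h12 : p 1 ≠ p 2 ∧ q 1 ≠ q 2) :
    K (ι (p 0) (q 0)) (ι (p 1) (q 1)) * K (ι (p 1) (q 1)) (ι (p 2) (q 2)) =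
      ((n - 1).factorial : ℂ) / (n.factorial : ℂ) * K (ι (p 0) (q 0)) (ι (p 2) (q 2)) ∧
    K (ι (p 2) (q 2)) (ι (p 1) (q 1)) * K (ι (p 1) (q 1)) (ι (p 0) (q 0)) =
      ((n - 1).factorial : ℂ) / (n.factorial : ℂ) * K (ι (p 2) (q 2)) (ι (p 0) (q 0)) ∧
    K (ι (p 0) (q 0)) (ι (p 1) (q 1)) * K (ι (p 1) (q 1)) (ι (p 0) (q 0)) =
      (((n - 1).factorial : ℂ) / (n.factorial : ℂ)) ^ 2 ∧
    K (ι (p 1) (q 1)) (ι (p 2) (q 2)) * K (ι (p 2) (q 2)) (ι (p 1) (q 1)) =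
      (((n - 1).factorial : ℂ) / (n.factorial : ℂ)) ^ 2
        - ((n - 2).factorial : ℂ) / (n.factorial : ℂ) := by
  obtain ⟨d0, d1, d2, w01, w02, w12, hdet⟩ := frame_triple hrepr hr hc hι p q hd
  rw [if_neg (fun h => h01.elim h.1 h.2), sub_zero] at w01
  rw [if_pos h02] at w02
  rw [if_pos h12] at w12
  obtain ⟨c1, c2⟩ := comp_of_minors (sq_sub_ne_zero hn) d0 d1 d2 w01 w12 w02 (hdet (Or.inl h01))
  exact ⟨c1, c2, w01, w12⟩

/-- **L-shape.** Corner `e₀` attacking both `e₁` and `e₂`, which do not attack each other: the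
two 3-cycle products `p = K(e₀,e₁)K(e₁,e₂)K(e₂,e₀)`, `q = K(e₀,e₂)K(e₂,e₁)K(e₁,e₀)` satisfy
`p + q = a³ + a v`, `p q = a⁴ v` with `v = a² - b`. [folklore] -/
theorem frame_L
    (hrepr : MvPolynomial.aeval (fun e => MvPolynomial.X e + 1) (perPoly (Fin n) ℂ) =
      MvPolynomial.C (n.factorial : ℂ) * (1 + Matrix.diagonal (fun i => MvPolynomial.X (κ i)) *
        K.map (fun a : ℂ => (MvPolynomial.C a : MvPolynomial (Fin n × Fin n) ℂ))).det)
    (hr : Function.Injective r) (hc : Function.Injective c)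
    (hι : ∀ p q j, κ j = (r p, c q) ↔ j = ι p q)
    (p q : Fin 3 → Fin 3) (hd : ∀ m m', p m = p m' → q m = q m' → m = m')
    (h01 : p 0 = p 1 ∨ q 0 = q 1) (h02 : p 0 = p 2 ∨ q 0 = q 2) (h12 : p 1 ≠ p 2 ∧ q 1 ≠ q 2) :
    K (ι (p 0) (q 0)) (ι (p 1) (q 1)) * K (ι (p 1) (q 1)) (ι (p 2) (q 2)) *
        K (ι (p 2) (q 2)) (ι (p 0) (q 0)) +
      K (ι (p 0) (q 0)) (ι (p 2) (q 2)) * K (ι (p 2) (q 2)) (ι (p 1) (q 1)) *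
        K (ι (p 1) (q 1)) (ι (p 0) (q 0)) =
      (((n - 1).factorial : ℂ) / (n.factorial : ℂ)) ^ 3 +
        ((n - 1).factorial : ℂ) / (n.factorial : ℂ) *
          ((((n - 1).factorial : ℂ) / (n.factorial : ℂ)) ^ 2
            - ((n - 2).factorial : ℂ) / (n.factorial : ℂ)) ∧
    (K (ι (p 0) (q 0)) (ι (p 1) (q 1)) * K (ι (p 1) (q 1)) (ι (p 2) (q 2)) *
        K (ι (p 2) (q 2)) (ι (p 0) (q 0))) *
      (K (ι (p 0) (q 0)) (ι (p 2) (q 2)) * K (ι (p 2) (q 2)) (ι (p 1) (q 1)) *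
        K (ι (p 1) (q 1)) (ι (p 0) (q 0))) =
      (((n - 1).factorial : ℂ) / (n.factorial : ℂ)) ^ 4 *
        ((((n - 1).factorial : ℂ) / (n.factorial : ℂ)) ^ 2
          - ((n - 2).factorial : ℂ) / (n.factorial : ℂ)) := by
  obtain ⟨d0, d1, d2, w01, w02, w12, hdet⟩ := frame_triple hrepr hr hc hι p q hd
  rw [if_neg (fun h => h01.elim h.1 h.2), sub_zero] at w01
  rw [if_neg (fun h => h02.elim h.1 h.2), sub_zero] at w02
  rw [if_pos h12] at w12
  exact L_of_minors d0 d1 d2 w01 w12 w02 (hdet (Or.inl h01))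

end Configurations

end Summit.ValiantsHypothesis.ValiantsHypothesis.Theorems.PrincipalMinorColouring
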